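import Summits.QuantumFields.YangMills.Theorems.UnitScaleTiltProp7ExistRouteAlphaMin
import Summits.QuantumFields.YangMills.Theorems.UnitScaleTiltProp7ClosedFibreMinimiser
import HarnessLib

/-!
# Route `UnitScaleTilt`, crux K1 child «MinimiserStabilityRegPr» (stmt-QuantumFields-19200), skeleton v10, stub `stub_existenceMinimalOrbit` — WHERE THE ENTRIES (α) AND (β′)
# MEET: route (α)'s two print statements C-min ∧ COV (w2 `Prop7ExistRouteAlphaMin`) give a minimiser over print's regular fibre AT A MACROSCOPIC RADIUS ρ₀ (not only at
# `O₁L³B₃ε₁`), and WITH PROP. 8 this yields the interiority sentence of route (β)∕(β′): EVERY closed-fibre minimiser at a fixed radius `R ≤ R₁` lies in `𝔘_k(R)` —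
# no uniqueness (Prop. 6's «exactly one», the banked row) is needed

Cell `ym3-torus`, width seat `ym-ust-19200-w4` (gen 0; OWNER RULING g25-№1: «★w4: (α)-side `interiorAtR_of_Cmin` (INTERIOR-AT-R as the (α)-corollary) so the (β′) and (α)
entries provably meet»).  THEOREMS ONLY (0 `def`, 0 `sorry`).  YM₃ on T³ is a ladder rung (R3), not the Clay problem; nothing here claims the stub, the crux, d = 4 or the gap.

THE POINT.  In `Prop7ExistRouteAlphaMin.existenceMinimalOrbit_of_Cmin_cov` the competitor's radius is tied to the minimiser's (`e = 178·M·L³B₃ε₁`), but the argument charts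
competitors of ANY radius `ρ` with `ρ ≤ e_ax(L)`, `ρ + L³ε₁ ≤ c₁`, `B₁(ρ + L³ε₁) ≤ a₄`: so C-min ∧ COV give `W ∈ (6)(O₁L³B₃ε₁) ∩ 𝔅_k(V)` minimising over `(6)(ρ)` for EVERY
`ρ ∈ [O₁L³B₃ε₁, ρ₀]`, `ρ₀ = min{e_ax, c₁/2, a₄/(2B₁)}` ABSOLUTE (§1, MIN-MACRO).  Then (§2): a minimiser `Ū` of (5) over the CLOSED fibre `(6̄)(R) ∩ 𝔅_k(V)`, `O₁L³B₃ε₁ ≤ R < ρ* := min{ρ₀, a₅}`,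
has `A(Ū) ≤ A(W)` (`W ∈ (6̄)(R)`) and `A(W) ≤ A(U)` for every `U ∈ (6)(ρ*) ⊇ (6̄)(R) ∋ Ū`, so `Ū` MINIMISES over the OPEN `(6)(ρ*)` and lies in it: `Ū` is R2-critical at the
macroscopic radius, and PROP. 8 ([Balaban1985Variational] p. 304: a critical configuration of (6)(ε₀), `ε₀ ≤ a₅`, over a (7)-datum lies in (8) = `𝔘_k(B₃ε₁)`) puts `Ū` in
`𝔘_k(B₃*ε₁) ⊆ 𝔘_k(R)`.  So: INTERIOR-AT-R (the sentence `hIR` of `Prop7ClosedFibreHalving.existenceMinimalOrbit_of_prop8_of_interiorAtR`) ⇐ `landed_prop8` ∧ MIN-MACRO ⇐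
`landed_prop8` ∧ C-min ∧ COV.

WHAT IS PROVED (ns `…Theorems.Prop7ClosedFibreInteriorOfRouteAlpha`).
§1 ★ `isMinOn_macro_of_Cmin_cov` — MIN-MACRO at `(L, B₃)` from C-min ∧ COV (hypothesis texts VERBATIM those of `existenceMinimalOrbit_of_Cmin_cov`; `O₁ = 178·max{1,3B₀}`).
§2 ★ `interiorAtR_of_prop8_of_minMacro` — `<landed_prop8 text> → (∀ L>1 ∀ B₃>4, MIN-MACRO) → hIR` (`R₁ = min{ρ₀, a₅}/2`, `a″₁(R) = min{a′₁, R/(O₁L³B₃), R/B₃*}`, `B₃*` Prop. 8's).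
§3 ★★ `interiorAtR_of_prop8_Cmin_cov` — `<landed_prop8 text> → (∀ L>1 ∀ B₃>4, C-min) → (∀ L>1 ∀ B₃>4, COV) → hIR`: the (α) and (β′) entries meet by name
   (feed `hIR` to `Prop7ClosedFibreHalving.existenceMinimalOrbit_of_prop8_of_interiorAtR`, or EX directly from `existenceMinimalOrbit_of_Cmin_cov`).

HONEST SCOPE.  Bookkeeping over w2's route-(α) spine, 20520-w4's closed fibre and p1's axial-gauge law; C-min, COV ([Balaban1985Variational] Props 4–6 + (116);
[Balaban1985RegularSpaces] Thm 2) and Prop. 8 stay displayed hypotheses; nothing of print is asserted; `--supports stmt-QuantumFields-19200`, count-neutral.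

References: T. Bałaban, CMP 102 (1985) 277–309 [Balaban1985Variational] ((2)–(8) pp.278–279, (14) p.280, (18)–(21) pp.280–281, Props 4–6 pp.291–295, (116) p.295, Prop. 7
p.299, Prop. 8 p.304); CMP 99 (1985) 75–102 [Balaban1985RegularSpaces] ((1.19) p.79, Thm 2 p.83, Prop. 7 (1.144) p.100).
-/

set_option autoImplicit false

noncomputable section

open scoped Matrix.Norms.L2Operator

namespace Summit.QuantumFields.YangMills.Theorems.Prop7ClosedFibreInteriorOfRouteAlpha

open Set
open Literature.MathematicalPhysics.QuantumFieldTheory.Balaban1983to89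
open Literature.MathematicalPhysics.QuantumFieldTheory.Balaban1983to89.T3ContinuumYM3Torus
open Literature.MathematicalPhysics.QuantumFieldTheory.Balaban1983to89.T3UnitLawDensityEML (ℰp)
open Literature.MathematicalPhysics.QuantumFieldTheory.Balaban1983to89.T3DescentFibreTower
open Literature.MathematicalPhysics.QuantumFieldTheory.Balaban1983to89.T3ConstrainedMinimiser
open Literature.MathematicalPhysics.QuantumFieldTheory.Balaban1983to89.T3TiltDescent
open Literature.MathematicalPhysics.QuantumFieldTheory.Balaban1983to89.T3PrintedRegularMinimiser
open Literature.MathematicalPhysics.QuantumFieldTheory.Balaban1983to89.T3PrintedMinimiserExistence (regPr_mono regFibrePr_mono)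
open Literature.MathematicalPhysics.QuantumFieldTheory.Balaban1983to89.T3RegularMinimiser (regThreshold)
open Literature.MathematicalPhysics.QuantumFieldTheory.Balaban1983to89.T3PrintedRegularOrbits (descTransf regPr_gaugeAct_iff gaugeAct_mem_regFibrePr_iff_of_trivial)
open Literature.MathematicalPhysics.QuantumFieldTheory.Balaban1983to89.T3Thm1Carrier
open Literature.MathematicalPhysics.QuantumFieldTheory.Balaban1983to89.T3Thm1CarrierNative (IsCritR2 isCritR2_of_isMinOn)
open Literature.MathematicalPhysics.QuantumFieldTheory.Balaban1983to89.T3SectALandauChart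
open Literature.MathematicalPhysics.QuantumFieldTheory.Balaban1983to89.B10Eq27TorusAxialLog (toUField unitsField)
open Literature.MathematicalPhysics.QuantumFieldTheory.Balaban1983to89.B10Eq68TorusRegularity (covDivT)
open B7Prop2Explicit (C0 c2' C0_pos c2'_pos)
open B8Thm4TorusAt (torusLam)
open Summit.QuantumFields.YangMills.Theorems.Prop7TPrint
open Summit.QuantumFields.YangMills.Theorems.Prop7SPrint
open Summit.QuantumFields.YangMills.Theorems.Prop7PV3CDELogChart (in19_expHermField_of_nMax19_lt nMax19_lt_of_in19 eq_expHermField_of_in19)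
open Summit.QuantumFields.YangMills.Theorems.Prop7B8Prop7Div (regPr_emb15_of_in19)
open Summit.QuantumFields.YangMills.Theorems.Prop7ChartPrint (axialRepr_print_based_uniform)
open Summit.QuantumFields.YangMills.Theorems.Prop7ClosedFibreMinimiser (regFibrePr_subset_closedRegFibre closedRegFibre_subset_regFibrePr)

variable {L : ℕ}

/-! ## §1 ★ MIN-MACRO: route (α)'s minimiser minimises over (6)(ρ) for every ρ up to an ABSOLUTE ρ₀ -/

/-- ★ **MIN-MACRO ⇐ C-min ∧ COV.**  With `M = max{1, 3B₀}`, `O₁ = 178M`, `e_ax = min{1/(6C₀(3)L³), c₂′(3,L)/(4L³)}`, `ρ₀ = min{e_ax, c₁/2, a₄/(2B₁)}`: for `ε₁ ≤ a′₁` (five smallness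
conditions incl. `O₁L³B₃ε₁ ≤ ρ₀`), every (7)-datum `V` with a background `U₀ ∈ 𝔘_k(L³B₃ε₁) ∩ 𝔅_k(V)` carries `W ∈ (6)(O₁L³B₃ε₁) ∩ 𝔅_k(V)` (Prop. 6's minimising `X`, axial
representative, row D's engine) which MINIMISES the Wilson action over `(6)(ρ)` for EVERY `ρ ∈ [O₁L³B₃ε₁, ρ₀]` — the proof of `Prop7ExistRouteAlphaMin.existenceMinimalOrbit_of_Cmin_cov`
with the competitor's radius decoupled (axial gauge (1.19) inside the (4)-orbit, COV's chart at `ε₂ = B₁(ρ + L³ε₁) ≤ a₄`, C-min's comparison, gauge invariance of (5)).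
[cite: Balaban1985Variational, Prop. 7 p.299, (112) p.294, (116) p.295, (141)-(142) p.299; Balaban1985RegularSpaces, Thm 2 p.83, (1.19) p.79] -/
theorem isMinOn_macro_of_Cmin_cov (hL : 1 < L) {B₃ : ℝ} (hB₃ : 4 < B₃)
    (hC : ∃ B₀ a₄ : ℝ, 0 < B₀ ∧ 0 < a₄ ∧ ∀ (i : Idx L) (ε₁ ε₄ : ℝ), 0 < ε₁ → ε₄ ≤ a₄ → 2 * B₀ * (L : ℝ) ^ 3 * B₃ * ε₁ ≤ ε₄ →
        ∀ (V : GaugeField (i.1.1.P i.1.2.1) 0 (Matrix.specialUnitaryGroup (Fin 2) ℂ)) (U₀ : GaugeField (i.1.1.P i.1.2.2) 0 (Matrix.specialUnitaryGroup (Fin 2) ℂ)),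
          PlaqSmall ε₁ V → RegPr i.1.1 i.1.2.1 i.1.2.2 ((L : ℝ) ^ 3 * B₃ * ε₁) U₀ → CloseAvg i.1.1 i.1.2.1 i.1.2.2 i.2.2.le ((L : ℝ) ^ 3 * ε₁) V U₀ →
          ∃ X : PBond (i.1.1.P i.1.2.2) 0 → Matrix (Fin 2) (Fin 2) ℂ,
            nMax19 i.1.1 i.1.2.1 i.1.2.2 U₀ X < 3 * B₀ * (L : ℝ) ^ 3 * B₃ * ε₁ ∧ (∀ b : PBond (i.1.1.P i.1.2.2) 0, (X b).IsHermitian ∧ Matrix.trace (X b) = 0) ∧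
            AvgCondPrint i.1.1 i.1.2.1 i.1.2.2 i.2.2.le V U₀ X ∧ IsLandauPrint i.1.1 i.1.2.1 i.1.2.2 U₀ X ∧
            ∀ X' : PBond (i.1.1.P i.1.2.2) 0 → Matrix (Fin 2) (Fin 2) ℂ, nMax19 i.1.1 i.1.2.1 i.1.2.2 U₀ X' < ε₄ → (∀ b : PBond (i.1.1.P i.1.2.2) 0, (X' b).IsHermitian ∧ Matrix.trace (X' b) = 0) →
              AvgCondPrint i.1.1 i.1.2.1 i.1.2.2 i.2.2.le V U₀ X' → IsLandauPrint i.1.1 i.1.2.1 i.1.2.2 U₀ X' →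
                wilsonAction4 (emb15 U₀ (expHermField X)) ≤ wilsonAction4 (emb15 U₀ (expHermField X')))
    (hV : ∃ B₁ c₁ : ℝ, 0 < B₁ ∧ 0 < c₁ ∧ ∀ (F : T3Family) (hF : F.L = L) (n K : ℕ) (hnK : n < K) (ε₀ ε₁ ε₂ : ℝ), 0 < ε₀ → 0 < ε₁ →
        ε₀ + (L : ℝ) ^ 3 * ε₁ ≤ c₁ → B₁ * (ε₀ + (L : ℝ) ^ 3 * ε₁) ≤ ε₂ →
        ∀ (V : GaugeField (F.P n) 0 (Matrix.specialUnitaryGroup (Fin 2) ℂ)) (U₀ : GaugeField (F.P K) 0 (Matrix.specialUnitaryGroup (Fin 2) ℂ)),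
          RegPr F n K ((L : ℝ) ^ 3 * B₃ * ε₁) U₀ → CloseAvg F n K hnK.le ((L : ℝ) ^ 3 * ε₁) V U₀ →
          ∀ U : GaugeField (F.P K) 0 (Matrix.specialUnitaryGroup (Fin 2) ℂ), U ∈ regFibrePr F n K hnK.le ε₀ V → IsAxialPrint F n K U₀ U →
            ∃ (u : GaugeTransf (F.P K) 0 (Matrix.specialUnitaryGroup (Fin 2) ℂ)) (U₁ : GaugeField (F.P K) 0 (Matrix.specialUnitaryGroup (Fin 2) ℂ))
              (X : PBond (F.P K) 0 → Matrix (Fin 2) (Fin 2) ℂ),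
              RestrictedPrint F n K U₀ u ∧ GaugeField.gaugeAct u (emb15 U₀ U₁) = U ∧ In19 F n K ε₂ U₀ U₁ X ∧
                AvgCondPrint F n K hnK.le V U₀ X ∧ IsLandauPrint F n K U₀ X) :
    ∃ ρ₀ a₁' O₁ : ℝ, 0 < ρ₀ ∧ 0 < a₁' ∧ 1 ≤ O₁ ∧
    ∀ (F : T3Family), F.L = L → ∀ (n K : ℕ) (hnK : n < K) (ε₁ : ℝ), 0 < ε₁ →
      ∀ V : GaugeField (F.P n) 0 (Matrix.specialUnitaryGroup (Fin 2) ℂ), PlaqSmall ε₁ V →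
        ∀ U₀ : GaugeField (F.P K) 0 (Matrix.specialUnitaryGroup (Fin 2) ℂ), RegPr F n K ((L : ℝ) ^ 3 * B₃ * ε₁) U₀ → U₀ ∈ fibre F ℰp n K hnK.le V →
          ε₁ ≤ a₁' → O₁ * (L : ℝ) ^ 3 * B₃ * ε₁ ≤ ρ₀ ∧
            ∃ W ∈ regFibrePr F n K hnK.le (O₁ * (L : ℝ) ^ 3 * B₃ * ε₁) V, ∀ ρ : ℝ, O₁ * (L : ℝ) ^ 3 * B₃ * ε₁ ≤ ρ → ρ ≤ ρ₀ →
              IsMinOn (fun W' : GaugeField (F.P K) 0 (Matrix.specialUnitaryGroup (Fin 2) ℂ) => wilsonAction4 W') (regFibrePr F n K hnK.le ρ V) W := by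
  have hL1 : (1 : ℝ) ≤ (L : ℝ) := by exact_mod_cast hL.le
  have hC₁ : (1 : ℝ) ≤ (L : ℝ) ^ 3 := one_le_pow₀ hL1
  have hC₁pos : (0 : ℝ) < (L : ℝ) ^ 3 := by positivity
  have hB₃0 : 0 < B₃ := by linarith
  have hB₃1 : 1 ≤ B₃ := by linarith
  have hC0 : 0 < C0 3 := C0_pos _
  have hc2 : 0 < c2' 3 L := c2'_pos _ _ hL.le
  set eax : ℝ := min (1 / (6 * C0 3 * (L : ℝ) ^ 3)) (c2' 3 L / (4 * (L : ℝ) ^ 3)) with heax_def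
  have heax : 0 < eax := lt_min (by positivity) (by positivity)
  obtain ⟨B₀, a₄, hB₀, ha₄, HC⟩ := hC
  obtain ⟨B₁, c₁, hB₁, hc₁, HV⟩ := hV
  set M : ℝ := max 1 (3 * B₀) with hM
  have hM1 : 1 ≤ M := le_max_left _ _
  have hM3 : 3 * B₀ ≤ M := le_max_right _ _
  have hM0 : 0 < M := lt_of_lt_of_le one_pos hM1
  -- the macroscopic radius
  set ρ₀ : ℝ := min eax (min (c₁ / 2) (a₄ / (2 * B₁))) with hρ₀_def
  have hρ₀ : 0 < ρ₀ := lt_min heax (lt_min (by positivity) (by positivity))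
  have hρ₀eax : ρ₀ ≤ eax := min_le_left _ _
  have hρ₀c₁ : ρ₀ ≤ c₁ / 2 := (min_le_right _ _).trans (min_le_left _ _)
  have hρ₀a₄ : ρ₀ ≤ a₄ / (2 * B₁) := (min_le_right _ _).trans (min_le_right _ _)
  have hK₁ : 0 < 2 * B₀ * (L : ℝ) ^ 3 * B₃ := by positivity
  have hK₄ : 0 < 178 * M * (L : ℝ) ^ 3 * B₃ := by positivity
  have hK₅ : 0 < M * (L : ℝ) ^ 3 * B₃ := by positivity
  set a₁' : ℝ := min (min (min (min (a₄ / (2 * B₀ * (L : ℝ) ^ 3 * B₃)) ((c₁ / 2) / (L : ℝ) ^ 3)) ((a₄ / (2 * B₁)) / (L : ℝ) ^ 3))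
    (ρ₀ / (178 * M * (L : ℝ) ^ 3 * B₃))) ((1 / 4) / (M * (L : ℝ) ^ 3 * B₃)) with ha₁'
  have ha₁'0 : 0 < a₁' :=
    lt_min (lt_min (lt_min (lt_min (div_pos ha₄ hK₁) (div_pos (by positivity) hC₁pos)) (div_pos (by positivity) hC₁pos)) (div_pos hρ₀ hK₄))
      (div_pos (by norm_num) hK₅)
  refine ⟨ρ₀, a₁', 178 * M, hρ₀, ha₁'0, le_trans hM1 (le_mul_of_one_le_left hM0.le (by norm_num)), ?_⟩
  intro F hF n K hnK ε₁ hε₁ V hVreg U₀ hU₀ hB hε₁a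
  -- the smallness facts carried by `ε₁ ≤ a₁'`
  have h1 : ε₁ ≤ a₄ / (2 * B₀ * (L : ℝ) ^ 3 * B₃) := hε₁a.trans ((min_le_left _ _).trans ((min_le_left _ _).trans ((min_le_left _ _).trans (min_le_left _ _))))
  have h2 : ε₁ ≤ (c₁ / 2) / (L : ℝ) ^ 3 := hε₁a.trans ((min_le_left _ _).trans ((min_le_left _ _).trans ((min_le_left _ _).trans (min_le_right _ _))))
  have h3 : ε₁ ≤ (a₄ / (2 * B₁)) / (L : ℝ) ^ 3 := hε₁a.trans ((min_le_left _ _).trans ((min_le_left _ _).trans (min_le_right _ _)))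
  have h4 : ε₁ ≤ ρ₀ / (178 * M * (L : ℝ) ^ 3 * B₃) := hε₁a.trans ((min_le_left _ _).trans (min_le_right _ _))
  have h5 : ε₁ ≤ (1 / 4) / (M * (L : ℝ) ^ 3 * B₃) := hε₁a.trans (min_le_right _ _)
  have h2B : 2 * B₀ * (L : ℝ) ^ 3 * B₃ * ε₁ ≤ a₄ := by have := (le_div_iff₀ hK₁).1 h1; linarith
  have hL3c₁ : (L : ℝ) ^ 3 * ε₁ ≤ c₁ / 2 := by have := (le_div_iff₀ hC₁pos).1 h2; linarith
  have hL3a₄ : (L : ℝ) ^ 3 * ε₁ ≤ a₄ / (2 * B₁) := by have := (le_div_iff₀ hC₁pos).1 h3; linarith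
  have hwindow : 178 * M * (L : ℝ) ^ 3 * B₃ * ε₁ ≤ ρ₀ := by have := (le_div_iff₀ hK₄).1 h4; linarith
  have hquarter : M * (L : ℝ) ^ 3 * B₃ * ε₁ ≤ 1 / 4 := by have := (le_div_iff₀ hK₅).1 h5; linarith
  -- the (14)-hypotheses at the carrier
  obtain ⟨hreg, hclose⟩ := sat14T3_of_mem_fibre (h := hnK.le) (mul_pos hC₁pos hε₁) hU₀ hB
  -- C-min at ε₄ = a₄: the minimising solution `X`
  obtain ⟨X, hX3, hXh, h20, h21, hXmin⟩ := HC ⟨(F, n, K), hF, hnK⟩ ε₁ a₄ hε₁ le_rfl h2B V U₀ hVreg hreg hclose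
  have hP0 : 0 ≤ (L : ℝ) ^ 3 * B₃ * ε₁ := by positivity
  have h19 : In19 F n K (M * (L : ℝ) ^ 3 * B₃ * ε₁) U₀ (expHermField X) X := by
    have hmono : 3 * B₀ * (L : ℝ) ^ 3 * B₃ * ε₁ ≤ M * (L : ℝ) ^ 3 * B₃ * ε₁ :=
      calc 3 * B₀ * (L : ℝ) ^ 3 * B₃ * ε₁ = (3 * B₀) * ((L : ℝ) ^ 3 * B₃ * ε₁) := by ring
        _ ≤ M * ((L : ℝ) ^ 3 * B₃ * ε₁) := mul_le_mul_of_nonneg_right hM3 hP0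
        _ = M * (L : ℝ) ^ 3 * B₃ * ε₁ := by ring
    exact in19_expHermField_of_nMax19_lt hXh (lt_of_lt_of_le hX3 hmono)
  have hlo : (L : ℝ) ^ 3 * B₃ * ε₁ ≤ M * (L : ℝ) ^ 3 * B₃ * ε₁ :=
    calc (L : ℝ) ^ 3 * B₃ * ε₁ = 1 * ((L : ℝ) ^ 3 * B₃ * ε₁) := (one_mul _).symm
      _ ≤ M * ((L : ℝ) ^ 3 * B₃ * ε₁) := mul_le_mul_of_nonneg_right hM1 hP0
      _ = M * (L : ℝ) ^ 3 * B₃ * ε₁ := by ring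
  obtain ⟨u, _hu, _hax, hWfib⟩ := h20 (expHermField X) h19.2.1
  have he0 : 0 < 178 * (M * (L : ℝ) ^ 3 * B₃ * ε₁) := by positivity
  have hRegW : RegPr F n K (178 * (M * (L : ℝ) ^ 3 * B₃ * ε₁)) (GaugeField.gaugeAct u (emb15 U₀ (expHermField X))) :=
    (regPr_gaugeAct_iff F he0.le u _).mpr (regPr_emb15_of_in19 (F := F) (n := n) (K := K) hquarter hlo hreg h19)
  have hWmem : GaugeField.gaugeAct u (emb15 U₀ (expHermField X)) ∈ regFibrePr F n K hnK.le (178 * (M * (L : ℝ) ^ 3 * B₃ * ε₁)) V :=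
    (mem_regFibrePr_iff F).mpr ⟨hWfib, hRegW⟩
  have hO : 178 * M * (L : ℝ) ^ 3 * B₃ * ε₁ = 178 * (M * (L : ℝ) ^ 3 * B₃ * ε₁) := by ring
  refine ⟨hwindow, GaugeField.gaugeAct u (emb15 U₀ (expHermField X)), by rw [hO]; exact hWmem, ?_⟩
  -- a competitor `U ∈ (6)(ρ) ∩ 𝔅_k(V)`, `O₁L³B₃ε₁ ≤ ρ ≤ ρ₀`
  intro ρ hρlo hρhi U hU
  have hρ0 : 0 < ρ := lt_of_lt_of_le (by rw [hO]; exact he0) hρlo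
  have h14 : Sat14T3 F n K hnK.le ((L : ℝ) ^ 3 * B₃ * ε₁) ((L : ℝ) ^ 3 * ε₁) V U₀ := ⟨hreg, hclose⟩
  have hεe : ρ ≤ min (1 / (6 * C0 3 * (L : ℝ) ^ 3)) (c2' 3 L / (4 * (L : ℝ) ^ 3)) := by
    rw [← heax_def]; exact hρhi.trans hρ₀eax
  have hB₃e : B₃ * ε₁ ≤ ρ := by
    have h0 : B₃ * ε₁ ≤ (L : ℝ) ^ 3 * B₃ * ε₁ := by
      rw [mul_assoc]; exact le_mul_of_one_le_left (by positivity) hC₁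
    have h178 : (1 : ℝ) ≤ 178 * M := le_trans hM1 (le_mul_of_one_le_left hM0.le (by norm_num))
    have h1' : (L : ℝ) ^ 3 * B₃ * ε₁ ≤ 178 * M * (L : ℝ) ^ 3 * B₃ * ε₁ :=
      calc (L : ℝ) ^ 3 * B₃ * ε₁ = 1 * ((L : ℝ) ^ 3 * B₃ * ε₁) := (one_mul _).symm
        _ ≤ (178 * M) * ((L : ℝ) ^ 3 * B₃ * ε₁) := mul_le_mul_of_nonneg_right h178 (by positivity)
        _ = 178 * M * (L : ℝ) ^ 3 * B₃ * ε₁ := by ring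
    exact h0.trans (h1'.trans hρlo)
  obtain ⟨v, hv, hvAx⟩ := axialRepr_print_based_uniform F hF hnK.le hC₁ B₃ ρ ε₁ V U₀ U hεe hB₃e h14 hU
  have hUv : GaugeField.gaugeAct v U ∈ regFibrePr F n K hnK.le ρ V :=
    (gaugeAct_mem_regFibrePr_iff_of_trivial F hnK.le hρ0.le hv U V).mpr hU
  have hUvax : IsAxialPrint F n K U₀ (GaugeField.gaugeAct v U) := hvAx _
  have hsum' : ρ + (L : ℝ) ^ 3 * ε₁ ≤ c₁ := by linarith [hρhi.trans hρ₀c₁]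
  have hε₂a₄ : B₁ * (ρ + (L : ℝ) ^ 3 * ε₁) ≤ a₄ := by
    have hρ' : ρ ≤ a₄ / (2 * B₁) := hρhi.trans hρ₀a₄
    have hs : ρ + (L : ℝ) ^ 3 * ε₁ ≤ a₄ / (2 * B₁) + a₄ / (2 * B₁) := add_le_add hρ' hL3a₄
    calc B₁ * (ρ + (L : ℝ) ^ 3 * ε₁) ≤ B₁ * (a₄ / (2 * B₁) + a₄ / (2 * B₁)) := mul_le_mul_of_nonneg_left hs hB₁.le
      _ = a₄ := by field_simp; ring
  obtain ⟨u', U₁', X', _hu', hUeq, h19', h20', h21'⟩ :=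
    HV F hF n K hnK ρ ε₁ (B₁ * (ρ + (L : ℝ) ^ 3 * ε₁)) hρ0 hε₁ hsum' le_rfl V U₀ hreg hclose (GaugeField.gaugeAct v U) hUv hUvax
  have hX'a₄ : nMax19 F n K U₀ X' < a₄ := nMax19_lt_of_in19 h19' hε₂a₄
  have hcmp := hXmin X' hX'a₄ h19'.1 h20' h21'
  have e₁' : U₁' = expHermField X' := eq_expHermField_of_in19 h19'
  have a1 : wilsonAction4 (GaugeField.gaugeAct u (emb15 U₀ (expHermField X))) = wilsonAction4 (emb15 U₀ (expHermField X)) :=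
    T4WilsonGaugeFlatDirection.wilsonAction_gaugeAct 1 u _
  have a2 : wilsonAction4 (GaugeField.gaugeAct v U) = wilsonAction4 U := T4WilsonGaugeFlatDirection.wilsonAction_gaugeAct 1 v U
  have a3 : wilsonAction4 (GaugeField.gaugeAct u' (emb15 U₀ U₁')) = wilsonAction4 (emb15 U₀ U₁') :=
    T4WilsonGaugeFlatDirection.wilsonAction_gaugeAct 1 u' _
  have a4 : wilsonAction4 (emb15 U₀ U₁') = wilsonAction4 U := by rw [← a3, hUeq, a2]
  have a5 : wilsonAction4 (emb15 U₀ (expHermField X')) = wilsonAction4 U := by rw [← e₁']; exact a4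
  show wilsonAction4 (GaugeField.gaugeAct u (emb15 U₀ (expHermField X))) ≤ wilsonAction4 U
  rw [a1, ← a5]
  exact hcmp

/-! ## §2 ★ INTERIOR-AT-R from PROP. 8 and MIN-MACRO -/

/-- ★ **EVERY CLOSED-FIBRE MINIMISER AT A FIXED RADIUS IS INTERIOR ⇐ PROP. 8 ∧ MIN-MACRO.**  `hP8` = v10's `landed_prop8` text verbatim; `hMM` = MIN-MACRO for all `L > 1`,
`B₃ > 4`.  With `ρ* = min{ρ₀, a₅}`, `R₁ = ρ*/2`, `a″₁(R) = min{a′₁, R/(O₁L³B₃), R/B₃*}` (`B₃*` Prop. 8's constant): a minimiser `Ū` of (5) over `(6̄)(R) ∩ 𝔅_k(V)`, `R ≤ R₁`, has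
`A(Ū) ≤ A(W)` (`W ∈ (6)(O₁L³B₃ε₁) ⊆ (6̄)(R)`) and minimises, through `W`, over the OPEN `(6)(ρ*) ⊇ (6̄)(R) ∋ Ū`, so it is R2-critical at the macroscopic radius and Prop. 8
gives `Ū ∈ 𝔘_k(B₃*ε₁) ⊆ 𝔘_k(R)` — the sentence `hIR` of `Prop7ClosedFibreHalving.existenceMinimalOrbit_of_prop8_of_interiorAtR`, with no uniqueness input.
[cite: Balaban1985Variational, Prop. 8 p.304, Prop. 7 p.299, (6)-(8) pp.278-279, (14) p.280] -/
theorem interiorAtR_of_prop8_of_minMacro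
    (hP8 : ∀ L : ℕ, 1 < L → ∃ B₃ : ℝ, 4 < B₃ ∧ B11.Prop8Printed B₃ (T3Thm1Carrier.famX L))
    (hMM : ∀ L : ℕ, 1 < L → ∀ B₃ : ℝ, 4 < B₃ → ∃ ρ₀ a₁' O₁ : ℝ, 0 < ρ₀ ∧ 0 < a₁' ∧ 1 ≤ O₁ ∧
    ∀ (F : T3Family), F.L = L → ∀ (n K : ℕ) (hnK : n < K) (ε₁ : ℝ), 0 < ε₁ →
      ∀ V : GaugeField (F.P n) 0 (Matrix.specialUnitaryGroup (Fin 2) ℂ), PlaqSmall ε₁ V →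
        ∀ U₀ : GaugeField (F.P K) 0 (Matrix.specialUnitaryGroup (Fin 2) ℂ), RegPr F n K ((L : ℝ) ^ 3 * B₃ * ε₁) U₀ → U₀ ∈ fibre F ℰp n K hnK.le V →
          ε₁ ≤ a₁' → O₁ * (L : ℝ) ^ 3 * B₃ * ε₁ ≤ ρ₀ ∧
            ∃ W ∈ regFibrePr F n K hnK.le (O₁ * (L : ℝ) ^ 3 * B₃ * ε₁) V, ∀ ρ : ℝ, O₁ * (L : ℝ) ^ 3 * B₃ * ε₁ ≤ ρ → ρ ≤ ρ₀ →
              IsMinOn (fun W' : GaugeField (F.P K) 0 (Matrix.specialUnitaryGroup (Fin 2) ℂ) => wilsonAction4 W') (regFibrePr F n K hnK.le ρ V) W) :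
    ∀ L : ℕ, 1 < L → ∀ B₃ : ℝ, 4 < B₃ → ∃ R₁ : ℝ, 0 < R₁ ∧ ∀ R : ℝ, 0 < R → R ≤ R₁ → ∃ a₁' : ℝ, 0 < a₁' ∧
      ∀ F : T3Family, F.L = L → ∀ (n K : ℕ) (hnK : n < K) (ε₁ : ℝ), 0 < ε₁ → ε₁ ≤ a₁' →
        ∀ V : GaugeField (F.P n) 0 (Matrix.specialUnitaryGroup (Fin 2) ℂ), PlaqSmall ε₁ V →
          ∀ U₀ : GaugeField (F.P K) 0 (Matrix.specialUnitaryGroup (Fin 2) ℂ), RegPr F n K ((L : ℝ) ^ 3 * B₃ * ε₁) U₀ →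
            U₀ ∈ fibre F ℰp n K hnK.le V →
            ∀ Ū : GaugeField (F.P K) 0 (Matrix.specialUnitaryGroup (Fin 2) ℂ),
              Ū ∈ {U : GaugeField (F.P K) 0 (Matrix.specialUnitaryGroup (Fin 2) ℂ) | ∀ p : Plaq (F.P K) 0,
                  GaugeGroup.dist1 (GaugeField.plaqHol U p) ≤ regThreshold F n K R} ∩ descendTo F ℰp n K hnK.le ⁻¹' {V} ∩
                {U | ∀ b : PBond (F.P K) 0, ‖covDivT 1 (unitsField (toUField U)) b.dir b.src‖ ≤ R * ((F.L : ℝ)⁻¹) ^ (3 * (K - n))} →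
              IsMinOn (fun W : GaugeField (F.P K) 0 (Matrix.specialUnitaryGroup (Fin 2) ℂ) => wilsonAction4 W)
                ({U : GaugeField (F.P K) 0 (Matrix.specialUnitaryGroup (Fin 2) ℂ) | ∀ p : Plaq (F.P K) 0,
                  GaugeGroup.dist1 (GaugeField.plaqHol U p) ≤ regThreshold F n K R} ∩ descendTo F ℰp n K hnK.le ⁻¹' {V} ∩
                {U | ∀ b : PBond (F.P K) 0, ‖covDivT 1 (unitsField (toUField U)) b.dir b.src‖ ≤ R * ((F.L : ℝ)⁻¹) ^ (3 * (K - n))}) Ū →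
              RegPr F n K R Ū := by
  intro L hL B₃ hB₃
  obtain ⟨Bs, hBs, hP⟩ := hP8 L hL
  have hBs0 : 0 < Bs := by linarith
  obtain ⟨a₅, ha₅, HP8⟩ := T3Thm1CarrierNative.prop8Printed_famX_iff_native.mp hP
  obtain ⟨ρ₀, a₁', O₁, hρ₀, ha₁', hO₁, HMM⟩ := hMM L hL B₃ hB₃
  have hB₃0 : 0 < B₃ := by linarith
  have hL0 : (0 : ℝ) < (L : ℝ) := by exact_mod_cast (show 0 < L by omega)
  have hO₁0 : 0 < O₁ := one_pos.trans_le hO₁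
  set ρs : ℝ := min ρ₀ a₅ with hρs_def
  have hρs : 0 < ρs := lt_min hρ₀ ha₅
  refine ⟨ρs / 2, by positivity, fun R hR hRle => ?_⟩
  have hD : 0 < O₁ * (L : ℝ) ^ 3 * B₃ := by positivity
  refine ⟨min a₁' (min (R / (O₁ * (L : ℝ) ^ 3 * B₃)) (R / Bs)), lt_min ha₁' (lt_min (div_pos hR hD) (div_pos hR hBs0)), ?_⟩
  intro F hF n K hnK ε₁ hε₁ hε₁a V hV U₀ hreg hfib Ū hŪ hmin
  have hε₁a₁ : ε₁ ≤ a₁' := hε₁a.trans (min_le_left _ _)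
  have hwinR : O₁ * (L : ℝ) ^ 3 * B₃ * ε₁ ≤ R := by
    have h1 : ε₁ ≤ R / (O₁ * (L : ℝ) ^ 3 * B₃) := hε₁a.trans ((min_le_right _ _).trans (min_le_left _ _))
    rw [le_div_iff₀ hD] at h1; linarith
  have hBsR : Bs * ε₁ ≤ R := by
    have h1 : ε₁ ≤ R / Bs := hε₁a.trans ((min_le_right _ _).trans (min_le_right _ _))
    rw [le_div_iff₀ hBs0] at h1; linarith
  have hRρs : R < ρs := by linarith
  obtain ⟨_, W, hW, hWmin⟩ := HMM F hF n K hnK ε₁ hε₁ V hV U₀ hreg hfib hε₁a₁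
  subst hF
  have hWminρ := hWmin ρs (hwinR.trans hRρs.le) (min_le_left _ _)
  have hWcl := regFibrePr_subset_closedRegFibre F hnK.le R V (regFibrePr_mono F hwinR V hW)
  have hŪopen : Ū ∈ regFibrePr F n K hnK.le ρs V := closedRegFibre_subset_regFibrePr F hnK.le hRρs V hŪ
  have hAeq : wilsonAction4 Ū ≤ wilsonAction4 W := hmin hWcl
  have hŪmin : IsMinOn (fun W' : GaugeField (F.P K) 0 (Matrix.specialUnitaryGroup (Fin 2) ℂ) => wilsonAction4 W') (regFibrePr F n K hnK.le ρs V) Ū := by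
    intro U hU
    show wilsonAction4 Ū ≤ wilsonAction4 U
    exact hAeq.trans (hWminρ hU)
  have hcrit : IsCritR2 F n K hnK.le V Ū := isCritR2_of_isMinOn hρs hŪopen hŪmin
  have hŪreg : RegPr F n K ρs Ū := ((mem_regFibrePr_iff F).mp hŪopen).2
  have h8 : RegPr F n K (Bs * ε₁) Ū := HP8 F rfl n K hnK ρs ε₁ hε₁ (min_le_right _ _) V Ū hV hŪreg hŪ.1.2 hcrit
  exact regPr_mono F hBsR h8

/-! ## §3 ★★ INTERIOR-AT-R from PROP. 8 ∧ C-min ∧ COV — the (α) and (β′) entries meet -/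

/-- ★★ **THE INTERIORITY SENTENCE OF ROUTE (β)∕(β′) AS THE (α)-COROLLARY, BY NAME**: `landed_prop8` ∧ (C-min at every `L > 1`, `B₃ > 4`) ∧ (COV likewise) ⇒ `hIR`
(§1 then §2).  Feed it to `Prop7ClosedFibreHalving.existenceMinimalOrbit_of_prop8_of_interiorAtR` to re-enter the stub EX from the (β) side; route (α) reaches EX directly by
`Prop7ExistRouteAlphaMin.existenceMinimalOrbit_of_Cmin_cov`.  No uniqueness (Prop. 6's «exactly one») is used. [cite: Balaban1985Variational, Prop. 7 p.299, Prop. 8 p.304, Props 4-6 pp.291-295; Balaban1985RegularSpaces, Thm 2 p.83] -/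
theorem interiorAtR_of_prop8_Cmin_cov
    (hP8 : ∀ L : ℕ, 1 < L → ∃ B₃ : ℝ, 4 < B₃ ∧ B11.Prop8Printed B₃ (T3Thm1Carrier.famX L))
    (hCall : ∀ L : ℕ, 1 < L → ∀ B₃ : ℝ, 4 < B₃ →
      ∃ B₀ a₄ : ℝ, 0 < B₀ ∧ 0 < a₄ ∧ ∀ (i : Idx L) (ε₁ ε₄ : ℝ), 0 < ε₁ → ε₄ ≤ a₄ → 2 * B₀ * (L : ℝ) ^ 3 * B₃ * ε₁ ≤ ε₄ →
        ∀ (V : GaugeField (i.1.1.P i.1.2.1) 0 (Matrix.specialUnitaryGroup (Fin 2) ℂ)) (U₀ : GaugeField (i.1.1.P i.1.2.2) 0 (Matrix.specialUnitaryGroup (Fin 2) ℂ)),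
          PlaqSmall ε₁ V → RegPr i.1.1 i.1.2.1 i.1.2.2 ((L : ℝ) ^ 3 * B₃ * ε₁) U₀ → CloseAvg i.1.1 i.1.2.1 i.1.2.2 i.2.2.le ((L : ℝ) ^ 3 * ε₁) V U₀ →
          ∃ X : PBond (i.1.1.P i.1.2.2) 0 → Matrix (Fin 2) (Fin 2) ℂ,
            nMax19 i.1.1 i.1.2.1 i.1.2.2 U₀ X < 3 * B₀ * (L : ℝ) ^ 3 * B₃ * ε₁ ∧ (∀ b : PBond (i.1.1.P i.1.2.2) 0, (X b).IsHermitian ∧ Matrix.trace (X b) = 0) ∧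
            AvgCondPrint i.1.1 i.1.2.1 i.1.2.2 i.2.2.le V U₀ X ∧ IsLandauPrint i.1.1 i.1.2.1 i.1.2.2 U₀ X ∧
            ∀ X' : PBond (i.1.1.P i.1.2.2) 0 → Matrix (Fin 2) (Fin 2) ℂ, nMax19 i.1.1 i.1.2.1 i.1.2.2 U₀ X' < ε₄ → (∀ b : PBond (i.1.1.P i.1.2.2) 0, (X' b).IsHermitian ∧ Matrix.trace (X' b) = 0) →
              AvgCondPrint i.1.1 i.1.2.1 i.1.2.2 i.2.2.le V U₀ X' → IsLandauPrint i.1.1 i.1.2.1 i.1.2.2 U₀ X' →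
                wilsonAction4 (emb15 U₀ (expHermField X)) ≤ wilsonAction4 (emb15 U₀ (expHermField X')))
    (hVall : ∀ L : ℕ, 1 < L → ∀ B₃ : ℝ, 4 < B₃ →
      ∃ B₁ c₁ : ℝ, 0 < B₁ ∧ 0 < c₁ ∧ ∀ (F : T3Family) (hF : F.L = L) (n K : ℕ) (hnK : n < K) (ε₀ ε₁ ε₂ : ℝ), 0 < ε₀ → 0 < ε₁ →
        ε₀ + (L : ℝ) ^ 3 * ε₁ ≤ c₁ → B₁ * (ε₀ + (L : ℝ) ^ 3 * ε₁) ≤ ε₂ →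
        ∀ (V : GaugeField (F.P n) 0 (Matrix.specialUnitaryGroup (Fin 2) ℂ)) (U₀ : GaugeField (F.P K) 0 (Matrix.specialUnitaryGroup (Fin 2) ℂ)),
          RegPr F n K ((L : ℝ) ^ 3 * B₃ * ε₁) U₀ → CloseAvg F n K hnK.le ((L : ℝ) ^ 3 * ε₁) V U₀ →
          ∀ U : GaugeField (F.P K) 0 (Matrix.specialUnitaryGroup (Fin 2) ℂ), U ∈ regFibrePr F n K hnK.le ε₀ V → IsAxialPrint F n K U₀ U →
            ∃ (u : GaugeTransf (F.P K) 0 (Matrix.specialUnitaryGroup (Fin 2) ℂ)) (U₁ : GaugeField (F.P K) 0 (Matrix.specialUnitaryGroup (Fin 2) ℂ))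
              (X : PBond (F.P K) 0 → Matrix (Fin 2) (Fin 2) ℂ),
              RestrictedPrint F n K U₀ u ∧ GaugeField.gaugeAct u (emb15 U₀ U₁) = U ∧ In19 F n K ε₂ U₀ U₁ X ∧
                AvgCondPrint F n K hnK.le V U₀ X ∧ IsLandauPrint F n K U₀ X) :
    ∀ L : ℕ, 1 < L → ∀ B₃ : ℝ, 4 < B₃ → ∃ R₁ : ℝ, 0 < R₁ ∧ ∀ R : ℝ, 0 < R → R ≤ R₁ → ∃ a₁' : ℝ, 0 < a₁' ∧
      ∀ F : T3Family, F.L = L → ∀ (n K : ℕ) (hnK : n < K) (ε₁ : ℝ), 0 < ε₁ → ε₁ ≤ a₁' →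
        ∀ V : GaugeField (F.P n) 0 (Matrix.specialUnitaryGroup (Fin 2) ℂ), PlaqSmall ε₁ V →
          ∀ U₀ : GaugeField (F.P K) 0 (Matrix.specialUnitaryGroup (Fin 2) ℂ), RegPr F n K ((L : ℝ) ^ 3 * B₃ * ε₁) U₀ →
            U₀ ∈ fibre F ℰp n K hnK.le V →
            ∀ Ū : GaugeField (F.P K) 0 (Matrix.specialUnitaryGroup (Fin 2) ℂ),
              Ū ∈ {U : GaugeField (F.P K) 0 (Matrix.specialUnitaryGroup (Fin 2) ℂ) | ∀ p : Plaq (F.P K) 0,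
                  GaugeGroup.dist1 (GaugeField.plaqHol U p) ≤ regThreshold F n K R} ∩ descendTo F ℰp n K hnK.le ⁻¹' {V} ∩
                {U | ∀ b : PBond (F.P K) 0, ‖covDivT 1 (unitsField (toUField U)) b.dir b.src‖ ≤ R * ((F.L : ℝ)⁻¹) ^ (3 * (K - n))} →
              IsMinOn (fun W : GaugeField (F.P K) 0 (Matrix.specialUnitaryGroup (Fin 2) ℂ) => wilsonAction4 W)
                ({U : GaugeField (F.P K) 0 (Matrix.specialUnitaryGroup (Fin 2) ℂ) | ∀ p : Plaq (F.P K) 0,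
                  GaugeGroup.dist1 (GaugeField.plaqHol U p) ≤ regThreshold F n K R} ∩ descendTo F ℰp n K hnK.le ⁻¹' {V} ∩
                {U | ∀ b : PBond (F.P K) 0, ‖covDivT 1 (unitsField (toUField U)) b.dir b.src‖ ≤ R * ((F.L : ℝ)⁻¹) ^ (3 * (K - n))}) Ū →
              RegPr F n K R Ū :=
  interiorAtR_of_prop8_of_minMacro hP8 fun L hL B₃ hB₃ => isMinOn_macro_of_Cmin_cov hL hB₃ (hCall L hL B₃ hB₃) (hVall L hL B₃ hB₃)

end Summit.QuantumFields.YangMills.Theorems.Prop7ClosedFibreInteriorOfRouteAlpha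

end
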